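import Literature.MathematicalPhysics.QuantumFieldTheory.Balaban1983to89.B9Eq389CubeLocalisedProjectionWindow
import Literature.MathematicalPhysics.QuantumFieldTheory.Balaban1983to89.B9Eq389CubeLocalisedProjectionAdjoint

/-!
# `Balaban1983to89.B9Eq389CubeLocalisedProjectionWindowAdjoint` — T. Bałaban, *Propagators for lattice gauge theories in a background field*, Commun. Math. Phys.
# **99** (1985) 389–434 [Balaban1985BackgroundPropagators] Cor 3.6 p. 408 with (3.87)–(3.89) p. 409, (3.8) p. 392, (3.26) p. 395: **THE `hcmp` LETTER OF S-P6′(γ)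
# WITH `∃ ε₀ > 0, κ > 0, C ≥ 0` FIRST** — for every volume, every `U ∈ U₁` with `‖U − 1‖ ≤ ε₀` and mutually adjoint transports, every block set `Z₀`, radius
# `r₀ > 0`, collar width `R > 0` and every BOND field `z` supported over `Z₀`:
# `‖D_U†z − projR Δ^η_U (Q̃′(U) × N.mkQ)(D_U†z)‖ ≤ ‖D_U†z − projR Δ^η_U Q̃′(U) (D_U†z)‖ + ε(ε₀, κ, C, β₂, r₀, R)·‖D_U†z‖` with `N` the collar cube around the
# `1`-neighbourhood of `Z₀` and `ε` the explicit constant of `B9Eq389CubeLocalisedProjectionWindow` — the composition of this lineage's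
# `exists_window_norm_sub_projR_collar_le` ((β), `∃ε₀` first) with `B9Eq389CubeLocalisedProjectionAdjoint` (the support of `D_U†z`, `R′ = R(U)`);
# route R2′ STEP B7′∕B8′, S-P6′(β)→(γ), instance-ledger row L10 (loc) of the pub-balaban NE9 chain

statement-level skeleton of published theorems with citation tags; proofs where landed; nothing here is a claim about the Yang–Mills mass gap

CITATION HEADER (lean-in-tree rule).  Audit cell `pub-balaban`, sub-cell `t4`, BINDER row NE9; filed by NE9 formalisation-swarm LEAF PROVER 05
(`b2b-balaban-t4-ne9-formalise-leaf-05`, gen 78) as a [folklore] COMPOSITION BY NAME of this lineage's `B9Eq389CubeLocalisedProjectionWindow.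
exists_window_norm_sub_projR_collar_le` and `B9Eq389CubeLocalisedProjectionAdjoint.adjoint_covDerivL2K_apply_eq_zero_of_far`, with ne9-leaf-06's
`B9Eq387CubeLocalisedProjectionLattice.projR_QprimeL2_eq_RofU`.  CONSUMER BY SHAPE: `B9Eq387CubeLocalisedProjection.cube_form_ge ∕ cube_form_ge′` (`hcmp`).
Source READ in the held text [Balaban1985BackgroundPropagators]: p. 408 Cor 3.6, p. 409 (3.87)–(3.89), p. 392 (3.8), p. 395 (3.26).  NOTHING of print's estimates is
asserted; `ε₀, κ, C` are the ROUTE's, UNVALUED.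

WHAT IS PROVED (sorry-free; proof lane — no `def`).
* **`exists_window_hcmp`** — the displayed statement above; inside the `∀` also the collinear-bond letter `0 ≤ β₂` (enters `C_Ψ` only); returned with `ε₀ ≤ 1`
  and the window fact `3^{d+1}((1 + 2M_φM_φ′ε₀)^{(d+1)(L−1)} − 1) < 1`.
HONEST SCOPE.  After this file the `hcmp` input of (γ) at the lattice displays NO operator slot, NO size letter and NO scalar window — structure (`U₁`, `hRS`, `φ`,
`3 ≤ L`, `ηL = 1`, `c₁ = L^{d+1}c₀`) and the route's unvalued `ε₀, κ, C` only; the (γ) coercivity input `hform` (B7′ ∕ SC) is NOT here; ONE averaging step on the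
diagonal.  NOT NE9 (cell pub-balaban: NE9 NOT PRINTED ∕ NOT PROVED; «NE9 ⇐ the named binders»; row WALLED ON A MODEL (O-NE9-1; #5 UNRULED); spine PROVED 0∕9; rung
(B)+1 on a finite T⁴ — NOT infinite volume, NOT mass gap, NOT Clay; HONEST DEPENDENCY: continuum YM on T⁴ ⇐ BetaPertH ∧ nine spine estimates (0/9 proved); BetaPertH ⇐
(D1) ∧ (D4) ∧ CAP+tail; G-an2-4 gates asym, D1 and NE2/3/4).  NEW file; nothing modified.  Net new unproved facts: 0.
-/

noncomputable section

set_option autoImplicit false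

open scoped InnerProductSpace BigOperators

namespace Literature.MathematicalPhysics.QuantumFieldTheory.Balaban1983to89.B9Eq389CubeLocalisedProjectionWindowAdjoint

open B4Sect5Torus (TSite tdist)
open B4Sect5Proof (latticeConst)
open B9SectCLatticeCarrier (Bond bpos unshift)
open B9Eq311L2Pairing (WL2)
open B9Eq319QprimeTorus (fineP blockCoord)
open B11Eq103H1Complex (SiteL2K BondL2K covDerivL2K covLaplaceSiteK projR)
open B7Prop1Explicit (U1)
open B9Eq310HessianOperator (adTransportW)
open B9Eq326OperatorAssembly (QprimeW RofU)
open B9Eq387CubeLocalisedProjectionLattice (projR_QprimeL2_eq_RofU)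
open B9Eq389CubeLocalisedProjectionAdjoint (adjoint_covDerivL2K_apply_eq_zero_of_far)
open B9Eq389CubeLocalisedProjectionWindow (exists_window_norm_sub_projR_collar_le)

variable {d : ℕ} (L : ℕ) [NeZero L] (hL : 3 ≤ L) {𝔸 : Type*} [NormedRing 𝔸] [NormedAlgebra ℂ 𝔸] [NormOneClass 𝔸]
  {W : Type*} [NormedAddCommGroup W] [InnerProductSpace ℂ W] [FiniteDimensional ℂ W] (φ : W ≃ₗ[ℂ] 𝔸) {Mφ Mφ' : ℝ}
  (hφ : ∀ w, ‖φ w‖ ≤ Mφ * ‖w‖) (hφ' : ∀ X, ‖φ.symm X‖ ≤ Mφ' * ‖X‖) (hMφ : 0 ≤ Mφ) (hMφ' : 0 ≤ Mφ')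
  (c₀ : ℝ) [Fact (0 < c₀)] (η : ℝ) (hη : 0 < η) (c₁ : ℝ) [Fact (0 < c₁)] (hc : c₁ = (L : ℝ) ^ (d + 1) * c₀) (hηL : η * L = 1)

include hL hφ hφ' hMφ hMφ' hη hc hηL in
/-- **THE `hcmp` LETTER OF (γ), `∃ ε₀ κ C` FIRST**: with `ε₀ ∈ (0,1]`, `κ > 0`, `C ≥ 0` of `exists_window_norm_sub_projR_collar_le` (before the volume and the
background), for every volume, every `U ∈ U₁` with `‖U(b) − 1‖ ≤ ε₀` and `hRS`, every `β₂ ≥ 0` (collinear-bond letter), every block set `Z₀`, `r₀ > 0`, `R > 0`,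
`Y₀ = {y : ∃ z₀ ∈ Z₀, d_m(z₀,y) ≤ 1}` (letter `hY₀`, as in `B9Eq389CubeLocalisedProjectionAdjoint`), `N` the submodule of the collar cube `{y : ∃ y₀ ∈ Y₀, d_m(y₀, y) < r₀ + R}` (letter `hN`) and every BOND field `z` vanishing on the bonds
based outside `Z₀`:  `‖D_U†z − projR Δ^η_U (Q′_U × N.mkQ)(D_U†z)‖ ≤ ‖D_U†z − projR Δ^η_U Q′_U (D_U†z)‖ + ε·‖D_U†z‖`, `D_U† = LinearMap.adjoint (covDerivL2K … R(U))`,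
`Q′_U = (L²-reading)⁻¹ ∘ Q̃′(U)`, `ε` the constant of `exists_window_norm_sub_projR_collar_le` — LITERALLY the `hcmp` binder of `cube_form_ge′`.
[folklore] composition BY NAME. [cite: Balaban1985BackgroundPropagators, Cor 3.6 p.408, (3.87)–(3.89) p.409, (3.8) p.392, (3.26) p.395] -/
theorem exists_window_hcmp :
    ∃ ε₀ κ C : ℝ, 0 < ε₀ ∧ ε₀ ≤ 1 ∧ 0 < κ ∧ 0 ≤ C ∧
      3 ^ (d + 1) * ((1 + 2 * Mφ * Mφ' * ε₀) ^ ((d + 1) * (L - 1)) - 1) < 1 ∧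
      ∀ (m : Fin (d + 1) → ℕ) [∀ i, NeZero (m i)] [∀ i, NeZero (fineP L m i)]
        (U : Bond (d + 1) (fineP L m) → 𝔸ˣ) (_hU : ∀ b, U b ∈ U1 𝔸) (_hUε : ∀ b, ‖(U b : 𝔸) - 1‖ ≤ ε₀)
        (_hRS : ∀ (b : Bond (d + 1) (fineP L m)) (v u : W), ⟪adTransportW φ U b v, u⟫_ℂ = ⟪v, adTransportW φ (fun b => (U b)⁻¹) b u⟫_ℂ)
        {β₂ : ℝ} (_hβ : 0 ≤ β₂) (_hcol : ∀ (y : TSite (d + 1) (fineP L m)) (μ : Fin (d + 1)), ‖(U (y, μ) : 𝔸) - U (unshift μ y, μ)‖ ≤ β₂)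
        (Z₀ : Finset (TSite (d + 1) m)) {Y₀ : Finset (TSite (d + 1) m)}
        (_hY₀ : Y₀ = Finset.univ.filter fun y => ∃ z₀ ∈ Z₀, tdist m z₀ y ≤ 1) {r₀ R : ℝ} (_hr₀ : 0 < r₀) (_hR : 0 < R)
        {N : Submodule ℂ (SiteL2K ℂ (d + 1) (fineP L m) c₀ W)}
        (_hN : ∀ f : SiteL2K ℂ (d + 1) (fineP L m) c₀ W, f ∈ N ↔
          ∀ x : TSite (d + 1) (fineP L m), blockCoord L m x ∉ {y : TSite (d + 1) m | ∃ y₀ ∈ Y₀, tdist m y₀ y < r₀ + R} →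
            WL2.equiv ℂ (fun _ : TSite (d + 1) (fineP L m) => c₀) W f x = 0)
        (z : BondL2K ℂ (d + 1) (fineP L m) c₀ W)
        (_hz : ∀ b : Bond (d + 1) (fineP L m), blockCoord L m (bpos b) ∉ Z₀ → WL2.equiv ℂ (fun _ : Bond (d + 1) (fineP L m) => c₀) W z b = 0),
        ‖LinearMap.adjoint (covDerivL2K ℂ c₀ ((η : ℂ))⁻¹ (adTransportW φ U)) z -
            projR (covLaplaceSiteK (c₀ := c₀) ((η : ℂ))⁻¹ (adTransportW φ U) (adTransportW φ fun b => (U b)⁻¹))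
              ((((WL2.linearEquiv ℂ ℂ (fun _ : TSite (d + 1) m => c₁)).symm.toLinearMap ∘ₗ QprimeW L m φ U (c₀ := c₀))).prod N.mkQ)
              (LinearMap.adjoint (covDerivL2K ℂ c₀ ((η : ℂ))⁻¹ (adTransportW φ U)) z)‖ ≤
          ‖LinearMap.adjoint (covDerivL2K ℂ c₀ ((η : ℂ))⁻¹ (adTransportW φ U)) z -
              projR (covLaplaceSiteK (c₀ := c₀) ((η : ℂ))⁻¹ (adTransportW φ U) (adTransportW φ fun b => (U b)⁻¹))
                ((WL2.linearEquiv ℂ ℂ (fun _ : TSite (d + 1) m => c₁)).symm.toLinearMap ∘ₗ QprimeW L m φ U (c₀ := c₀))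
                (LinearMap.adjoint (covDerivL2K ℂ c₀ ((η : ℂ))⁻¹ (adTransportW φ U)) z)‖ +
            (C * latticeConst (d + 1) (κ / 2) * Real.exp (-(κ / 2 * r₀)) +
              Real.sqrt ((d + 1 : ℕ) : ℝ) * ((L : ℝ) / R * (Mφ * Mφ' + 1)) * (Real.sqrt (1 / 8))⁻¹ +
              (((d + 1 : ℕ) : ℝ) * (2 * (L : ℝ) ^ 2 / R) +
                ((1 - 3 ^ (d + 1) * ((1 + 2 * Mφ * Mφ' * ε₀) ^ ((d + 1) * (L - 1)) - 1))⁻¹ *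
                  ((d + 1 : ℕ) * (3 / 2 : ℝ) ^ (d + 1) * (9 * Real.pi ^ 2) * 2 ^ (d + 1 - 1) +
                    (d + 1 : ℕ) * 3 ^ (d + 1) * ((L : ℝ) ^ 2 * (Mφ' * Mφ * (2 * β₂ + 4 * ε₀ ^ 2))) +
                    (d + 1 : ℕ) * (3 / 2 : ℝ) ^ (d + 1) * (6 * Real.pi) * 2 ^ (d + 1 - 1) * ((L : ℝ) * (2 * Mφ * Mφ' * ε₀)))) *
                ((1 + 2 * Mφ * Mφ' * ε₀) ^ ((d + 1) * (L - 1)) * (((d + 1 : ℕ) : ℝ) * ((L : ℝ) / R)))) * ((Real.sqrt (1 / 8))⁻¹) ^ 2) *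
              ‖LinearMap.adjoint (covDerivL2K ℂ c₀ ((η : ℂ))⁻¹ (adTransportW φ U)) z‖ := by
  obtain ⟨ε₀, κ, C, hε₀, hε₀1, hκ, hC, hq, H⟩ :=
    exists_window_norm_sub_projR_collar_le (d := d) L hL φ hφ hφ' hMφ hMφ' c₀ η hη c₁ hc hηL
  refine ⟨ε₀, κ, C, hε₀, hε₀1, hκ, hC, hq, fun m _ _ U hU hUε hRS β₂ hβ hcol Z₀ Y₀ hY₀ r₀ R hr₀ hR N hN z hz => ?_⟩
  have hm : ∀ i, 1 ≤ m i := fun i => Nat.one_le_iff_ne_zero.mpr (NeZero.ne (m i))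
  -- `D_U†z` is supported over the `1`-neighbourhood `Y₀` of `Z₀`
  have hw : ∀ x : TSite (d + 1) (fineP L m), blockCoord L m x ∉ Y₀ →
      WL2.equiv ℂ (fun _ : TSite (d + 1) (fineP L m) => c₀) W (LinearMap.adjoint (covDerivL2K ℂ c₀ ((η : ℂ))⁻¹ (adTransportW φ U)) z) x = 0 :=
    fun x hx => by
    have hfar : ∀ z₀ ∈ Z₀, 1 < tdist m z₀ (blockCoord L m x) := fun z₀ hz₀ => by
      by_contra hle
      exact hx (by rw [hY₀, Finset.mem_filter]; exact ⟨Finset.mem_univ _, z₀, hz₀, le_of_not_gt hle⟩)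
    exact adjoint_covDerivL2K_apply_eq_zero_of_far L m hm η (adTransportW φ U) (adTransportW φ fun b => (U b)⁻¹) hRS z Z₀ hz x hfar
  -- `R′ = R(U)` at the letters, then (β) with `∃ε₀` first at `w = D_U†z`
  rw [projR_QprimeL2_eq_RofU L m φ (c₁ := c₁) η U]
  exact H m U hU hUε hRS hβ hcol _ hr₀ hR hN _ hw

end Literature.MathematicalPhysics.QuantumFieldTheory.Balaban1983to89.B9Eq389CubeLocalisedProjectionWindowAdjoint

end
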